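import Mathlib.Order.ConditionallyCompleteLattice.Basic
import Mathlib.Order.Lattice.Nat
import HarnessLib

/-!
# [OURS · L1 W4.2] σ-LAYER — `Corridor3SigmaMinLengthKernel`: the scheme-free MIN-LENGTH kernel («ι := the minimal length of a resolving sequence; playing the
# first step of SOME minimal sequence makes it drop by exactly one; ι is never re-chosen ad lib» — RULING v3.14-42 (KF)(c), CHAIN v3.24 §0w (N″)/(d-79)/(r-78)),
# abstracted from this seat's point-blow-up instance (`minLength` / `IsShortestFirstCentre`, p543674) to an ARBITRARY step relation on states
# (crux chain w42 `SigmaMaxModifications` stmt-ResolutionOfSingularities-18506 / conjunct `SigmaMaxModificationsCorridor3` stmt-ResolutionOfSingularities-19249;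
# helper of res-L1-w42-stub-1 (gen 5), `--supports stmt-…-19249 --as helper`, counted 0)

HONEST FRAMING. OURS, scheme-free bookkeeping (graph distance to a goal set); no algebraic geometry, no named fact, NOT a statement of H. Hironaka's manuscript
[Hironaka2017] nor of [CossartJannsenSaito2020]. Offered to the TAME-tier currency ι (idea-2 r14 / res-D-pv-002 / res-L1-w42-plan-1): instantiate `Step` with
«one 𝓑-permissible in-stratum blow-up of the germ-with-history» and `Good` with «resolved», and `Rel` with «isomorphic germs-with-history» for model-independence.
AI-written; AI review is weaker than expert review.

## Contents (namespace `…Theorems.SigmaMaxModificationsCorridor3.Sigma.MinLen`)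

* `PathN Step n s t` (a `Step`-path of length `n` from `s` to `t`, first step first), `PathN.append`; `ResolvesIn Step Good n s` (some length-`n` path from `s` ends
  in `Good`), `resolvesIn_zero_iff`, `resolvesIn_succ_iff` (FIRST-STEP form).
* `minLen Step Good s := sInf {n | ResolvesIn Step Good n s}` = **ι(s)** (`0` if `s` never resolves): `minLen_spec`, `minLen_le`, `minLen_eq_zero_iff`.
* **`IsShortestFirstStep Step Good s t`** (a step `s → t` beginning SOME minimal resolving path), `exists_isShortestFirstStep` (`0 < ι(s)` ⇒ one exists),
  **`IsShortestFirstStep.minLen_succ_eq`** (`ι(t) + 1 = ι(s)`: playing it drops ι by exactly one), `minLen_le_minLen_succ_of_step` (any resolving step costs at most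
  one: `ι(s) ≤ ι(t) + 1` — so ι NEVER DROPS BY MORE THAN ONE and a non-minimal step may keep or raise it: d-79).
* MODEL-INDEPENDENCE: `minLen_eq_of_bisim` — a relation `Rel` on states that preserves `Good` and SIMULATES steps both ways (every step from `s` is matched from
  `s′` up to `Rel`, and conversely) preserves ι; hence «for EVERY model `t′` of the first centre, `ι(t′) + 1 = ι(s)`» (`IsShortestFirstStep.minLen_succ_eq_of_rel`).

VACUITY SELF-CHECK. Pure order/induction on ℕ; `PathN.nil` inhabits length `0`; with no resolving path `minLen = 0` and `IsShortestFirstStep` is empty (honest).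
The point-blow-up ℓ of PHASE B′ (p543674/p548141) is the geometric instance that motivated it; this file does not restate it.
-/

set_option linter.dupNamespace false -- mandated namespace of this single-conjunct summit

namespace Summit.ResolutionOfSingularities.ResolutionOfSingularities.Theorems.SigmaMaxModificationsCorridor3.Sigma.MinLen

variable {σ : Type*} (Step : σ → σ → Prop) (Good : σ → Prop)

/-- [OURS · L1 W4.2] **A `Step`-PATH OF LENGTH `n` from `s` to `t`** (first step first). NOT a statement of the manuscript. [folklore] -/
inductive PathN (Step : σ → σ → Prop) : ℕ → σ → σ → Prop
  /-- the empty path -/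
  | nil (s : σ) : PathN Step 0 s s
  /-- a first step `s → t` followed by a path of length `n` from `t` -/
  | cons {n : ℕ} {s t u : σ} : Step s t → PathN Step n t u → PathN Step (n + 1) s u

variable {Step Good}

/-- Paths concatenate, lengths add. [folklore] -/
theorem PathN.append : ∀ {m : ℕ} {s t : σ}, PathN Step m s t → ∀ {n : ℕ} {u : σ}, PathN Step n t u → PathN Step (n + m) s u := by
  intro m s t h
  induction h with
  | nil s => intro n u h'; simpa using h'
  | cons hst _ ih =>
    intro n u h'
    have h'' := PathN.cons hst (ih h')
    rwa [Nat.add_assoc] at h''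

/-- A single step is a path of length `1`. [folklore] -/
theorem PathN.single {s t : σ} (h : Step s t) : PathN Step 1 s t :=
  PathN.cons h (PathN.nil t)

/-- A path of length `0` does not move. [folklore] -/
theorem PathN.eq_of_zero {s t : σ} (h : PathN Step 0 s t) : s = t := by
  cases h
  rfl

variable (Step Good) in
/-- [OURS · L1 W4.2] **`s` RESOLVES IN EXACTLY `n` STEPS**: some `Step`-path of length `n` from `s` ends in a `Good` state. NOT a statement of the manuscript.
[folklore] -/
def ResolvesIn (n : ℕ) (s : σ) : Prop :=
  ∃ t, PathN Step n s t ∧ Good t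

/-- Length `0`: `s` itself is good. [folklore] -/
theorem resolvesIn_zero_iff {s : σ} : ResolvesIn Step Good 0 s ↔ Good s := by
  constructor
  · rintro ⟨t, h, ht⟩
    cases h
    exact ht
  · exact fun h => ⟨s, PathN.nil s, h⟩

/-- **FIRST-STEP FORM**: `s` resolves in `n + 1` steps iff some step `s → t` leads to a state resolving in `n` steps. [folklore] -/
theorem resolvesIn_succ_iff {n : ℕ} {s : σ} : ResolvesIn Step Good (n + 1) s ↔ ∃ t, Step s t ∧ ResolvesIn Step Good n t := by
  constructor
  · rintro ⟨u, h, hu⟩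
    cases h with
    | cons hst htu => exact ⟨_, hst, u, htu, hu⟩
  · rintro ⟨t, hst, u, htu, hu⟩
    exact ⟨u, PathN.cons hst htu, hu⟩

variable (Step Good) in
/-- [OURS · L1 W4.2] **ι(s) — THE MINIMAL RESOLVING LENGTH** from `s` (`sInf`; `0` if `s` never resolves). NOT a statement of the manuscript. [folklore] -/
noncomputable def minLen (s : σ) : ℕ :=
  sInf {n | ResolvesIn Step Good n s}

/-- Some path of length `ι(s)` resolves (if any does). [folklore] -/
theorem minLen_spec {s : σ} (h : ∃ n, ResolvesIn Step Good n s) : ResolvesIn Step Good (minLen Step Good s) s :=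
  Nat.sInf_mem h

/-- `ι(s)` is at most the length of any resolving path. [folklore] -/
theorem minLen_le {s : σ} {n : ℕ} (h : ResolvesIn Step Good n s) : minLen Step Good s ≤ n :=
  Nat.sInf_le h

/-- If `0 < ι(s)` some resolving path exists. [folklore] -/
theorem exists_resolvesIn_of_minLen_pos {s : σ} (h : 0 < minLen Step Good s) : ∃ n, ResolvesIn Step Good n s :=
  Nat.nonempty_of_pos_sInf h

/-- **`ι(s) = 0` iff `s` is good** (given that `s` resolves at all). [folklore] -/
theorem minLen_eq_zero_iff {s : σ} (h : ∃ n, ResolvesIn Step Good n s) : minLen Step Good s = 0 ↔ Good s := by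
  rw [← resolvesIn_zero_iff (Step := Step) (Good := Good) (s := s)]
  exact ⟨fun h0 => h0 ▸ minLen_spec h, fun h0 => Nat.le_zero.mp (minLen_le h0)⟩

variable (Step Good) in
/-- [OURS · L1 W4.2] **`s → t` IS A SHORTEST FIRST STEP**: a step beginning SOME resolving path of minimal length `ι(s)`. (The policy's «own move» for ι: play
any such step; ι is NOT re-chosen from a fresh sequence — d-79.) NOT a statement of the manuscript. [folklore] -/
def IsShortestFirstStep (s t : σ) : Prop :=
  Step s t ∧ ∃ n, n + 1 = minLen Step Good s ∧ ResolvesIn Step Good n t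

/-- A shortest first step is a step. [folklore] -/
theorem IsShortestFirstStep.step {s t : σ} (h : IsShortestFirstStep Step Good s t) : Step s t :=
  h.1

/-- A shortest first step forces `0 < ι(s)`. [folklore] -/
theorem IsShortestFirstStep.minLen_pos {s t : σ} (h : IsShortestFirstStep Step Good s t) : 0 < minLen Step Good s := by
  obtain ⟨-, n, hn, -⟩ := h
  omega

/-- **Existence: if `0 < ι(s)` there is a shortest first step.** [folklore] -/
theorem exists_isShortestFirstStep {s : σ} (h : 0 < minLen Step Good s) : ∃ t, IsShortestFirstStep Step Good s t := by
  obtain ⟨m, hm⟩ : ∃ m, minLen Step Good s = m + 1 := ⟨minLen Step Good s - 1, (Nat.succ_pred_eq_of_pos h).symm⟩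
  have hspec : ResolvesIn Step Good (m + 1) s := hm ▸ minLen_spec (exists_resolvesIn_of_minLen_pos h)
  obtain ⟨t, hst, ht⟩ := resolvesIn_succ_iff.mp hspec
  exact ⟨t, hst, m, hm.symm, ht⟩

/-- **Any resolving step costs at most one**: `Step s t` with `t` resolvable gives `ι(s) ≤ ι(t) + 1`. (So ι never drops by more than one; a non-minimal step may keep
or raise it.) [folklore] -/
theorem minLen_le_minLen_succ_of_step {s t : σ} (hst : Step s t) (ht : ∃ n, ResolvesIn Step Good n t) : minLen Step Good s ≤ minLen Step Good t + 1 :=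
  minLen_le (resolvesIn_succ_iff.mpr ⟨t, hst, minLen_spec ht⟩)

/-- **PLAYING A SHORTEST FIRST STEP DROPS ι BY EXACTLY ONE**: `ι(t) + 1 = ι(s)`. [folklore] -/
theorem IsShortestFirstStep.minLen_succ_eq {s t : σ} (h : IsShortestFirstStep Step Good s t) : minLen Step Good t + 1 = minLen Step Good s := by
  obtain ⟨hst, n, hn, ht⟩ := h
  refine le_antisymm ?_ (minLen_le_minLen_succ_of_step hst ⟨n, ht⟩)
  have h1 : minLen Step Good t ≤ n := minLen_le ht
  omega

/-- … in particular `ι(t) < ι(s)` and `t` is resolvable. [folklore] -/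
theorem IsShortestFirstStep.minLen_lt {s t : σ} (h : IsShortestFirstStep Step Good s t) :
    (∃ n, ResolvesIn Step Good n t) ∧ minLen Step Good t < minLen Step Good s := by
  obtain ⟨-, n, hn, ht⟩ := id h
  exact ⟨⟨n, ht⟩, by have := h.minLen_succ_eq; omega⟩

/-! ## Model-independence: ι is invariant under a bisimulation preserving `Good` -/

variable (Step Good) in
/-- [OURS · L1 W4.2] **A BISIMULATION FOR (`Step`, `Good`)**: `Rel`-related states are good together and every step from one is matched by a step from the other
up to `Rel` (intended: «isomorphic germs-with-history»; two models of the same blow-up are related). NOT a statement of the manuscript. [folklore] -/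
def IsBisim (Rel : σ → σ → Prop) : Prop :=
  ∀ s s', Rel s s' → (Good s ↔ Good s') ∧ (∀ t, Step s t → ∃ t', Step s' t' ∧ Rel t t') ∧ (∀ t', Step s' t' → ∃ t, Step s t ∧ Rel t t')

/-- Resolving lengths transfer along a bisimulation. [folklore] -/
theorem ResolvesIn.of_rel {Rel : σ → σ → Prop} (hR : IsBisim Step Good Rel) :
    ∀ {n : ℕ} {s s' : σ}, Rel s s' → ResolvesIn Step Good n s → ResolvesIn Step Good n s' := by
  intro n
  induction n with
  | zero =>
    intro s s' hss' h
    rw [resolvesIn_zero_iff] at h ⊢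
    exact (hR s s' hss').1.mp h
  | succ n ih =>
    intro s s' hss' h
    obtain ⟨t, hst, ht⟩ := resolvesIn_succ_iff.mp h
    obtain ⟨t', hs't', htt'⟩ := (hR s s' hss').2.1 t hst
    exact resolvesIn_succ_iff.mpr ⟨t', hs't', ih htt' ht⟩

/-- The reverse of a bisimulation is a bisimulation. [folklore] -/
theorem IsBisim.flip {Rel : σ → σ → Prop} (hR : IsBisim Step Good Rel) : IsBisim Step Good (flip Rel) := by
  intro s s' h
  obtain ⟨hg, h1, h2⟩ := hR s' s h
  exact ⟨hg.symm, fun t hst => (h2 t hst).imp fun t' ht' => ⟨ht'.1, ht'.2⟩, fun t' hs't' => (h1 t' hs't').imp fun t ht => ⟨ht.1, ht.2⟩⟩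

/-- **ι IS MODEL-INDEPENDENT**: bisimilar states have the same minimal resolving length. [folklore] -/
theorem minLen_eq_of_bisim {Rel : σ → σ → Prop} (hR : IsBisim Step Good Rel) {s s' : σ} (h : Rel s s') : minLen Step Good s = minLen Step Good s' := by
  unfold minLen
  congr 1
  ext n
  exact ⟨ResolvesIn.of_rel hR h, ResolvesIn.of_rel hR.flip h⟩

/-- **FOR EVERY MODEL OF A SHORTEST FIRST STEP ι DROPS BY ONE**: if `s → t` is a shortest first step and `t′` is bisimilar to `t` (e.g. another model of the same
blow-up), then `ι(t′) + 1 = ι(s)`. [folklore] -/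
theorem IsShortestFirstStep.minLen_succ_eq_of_rel {Rel : σ → σ → Prop} (hR : IsBisim Step Good Rel) {s t t' : σ} (h : IsShortestFirstStep Step Good s t)
    (htt' : Rel t t') : minLen Step Good t' + 1 = minLen Step Good s := by
  rw [← minLen_eq_of_bisim hR htt']
  exact h.minLen_succ_eq

end Summit.ResolutionOfSingularities.ResolutionOfSingularities.Theorems.SigmaMaxModificationsCorridor3.Sigma.MinLen
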